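import Mathlib
import Summits.Ventures.HodgeRepro2.T5InertiaDegree

/-!
# Unramified from the residue degree: `f = [E : F]` forces `𝔭_{R₀} 𝒪_E = 𝔭_{𝒪_E}`

Blind cell `pub-hodge-repro2`, seat p8 (gen 13), Tier-5 kernel support.  The inert-place package
(`T5GaloisCartanThree`, `T5GaloisHeckeBase`) takes «`E_v / F_v` unramified» in the form
`hunr : 𝔭_{R₀} 𝒪_E = 𝔭_{𝒪_E}` (`e = 1`).  The record states the inert places through the RESIDUE
fields: `𝒪_{E_v} / 𝔭_{E_v}` is the quadratic extension of `𝒪_{F_v} / 𝔭_{F_v}`, i.e. `f = 2 = [E_v : F_v]`.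
This file is the converse of `T5InertiaDegree`: from `e · f = [E : F]` (Mathlib's fundamental
identity, local form) and `f = [E : F]` one gets `e = 1`, hence `hunr`
(`T5UnramifiedUniformiser.map_eq_of_ramificationIdx'_eq_one`):

* `ramificationIdx'_eq_one_of_inertiaDeg'_eq` — `f = [E : F] ⇒ e = 1`;
* `map_maximalIdeal_eq_of_inertiaDeg'_eq` — **`f = [E : F] ⇒ 𝔭_{R₀} 𝒪_E = 𝔭_{𝒪_E}`**;
* `map_maximalIdeal_eq_of_finrank_residueField_eq` — the same with `f` written as
  `[𝒪_E / 𝔪_E : R₀ / 𝔭]`, and `map_maximalIdeal_eq_of_finrank_residueField_eq_two` for the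
  quadratic case (`[E : F] = 2`, residue degree `2`).

README §8(d): uses an L-value-free non-vanishing device: NO.
-/

namespace Summit.Ventures.HodgeRepro2.T5UnramifiedOfInertia

open IsLocalRing Ideal

variable (R₀ F E : Type*) [CommRing R₀] [IsDomain R₀] [IsDiscreteValuationRing R₀] [Field F]
  [Field E] [Algebra R₀ F] [IsFractionRing R₀ F] [Algebra F E] [Algebra R₀ E]
  [IsScalarTower R₀ F E] [FiniteDimensional F E] [Algebra.IsSeparable F E]
  [IsLocalRing (integralClosure R₀ E)]

include F in
/-- `f = [E : F] ⇒ e = 1` (from `e · f = [E : F]`, `[E : F] ≠ 0`). -/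
theorem ramificationIdx'_eq_one_of_inertiaDeg'_eq
    (hf : inertiaDeg' (maximalIdeal R₀) (maximalIdeal (integralClosure R₀ E)) =
      Module.finrank F E) :
    ramificationIdx' (maximalIdeal R₀) (maximalIdeal (integralClosure R₀ E)) = 1 := by
  have h := T5InertiaDegree.ramificationIdx'_mul_inertiaDeg' R₀ F E
  rw [hf] at h
  have hn : Module.finrank F E ≠ 0 := Module.finrank_pos.ne'
  exact (mul_eq_right₀ hn).mp h

include F in
/-- **`f = [E : F] ⇒ 𝔭_{R₀} 𝒪_E = 𝔭_{𝒪_E}`**: the unramified hypothesis of the inert-place package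
from the residue degree. -/
theorem map_maximalIdeal_eq_of_inertiaDeg'_eq
    (hf : inertiaDeg' (maximalIdeal R₀) (maximalIdeal (integralClosure R₀ E)) =
      Module.finrank F E) :
    (maximalIdeal R₀).map (algebraMap R₀ (integralClosure R₀ E)) =
      maximalIdeal (integralClosure R₀ E) := by
  haveI := T5UnramifiedUniformiser.isDiscreteValuationRing_integralClosure R₀ F E
  refine T5UnramifiedUniformiser.map_eq_of_ramificationIdx'_eq_one ?_ ?_
    (ramificationIdx'_eq_one_of_inertiaDeg'_eq R₀ F E hf)
  · refine T5UnramifiedUniformiser.map_maximalIdeal_ne_bot ?_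
    have h : algebraMap R₀ E = (algebraMap (integralClosure R₀ E) E).comp
        (algebraMap R₀ (integralClosure R₀ E)) := IsScalarTower.algebraMap_eq _ _ _
    have hinj := T5UnramifiedUniformiser.algebraMap_injective R₀ F E
    rw [h, RingHom.coe_comp] at hinj
    exact hinj.of_comp
  · exact T5ResidueFieldFinite.map_maximalIdeal_le_maximalIdeal R₀ F E

include F in
/-- The same with `f` written as the degree of the residue field extension. -/
theorem map_maximalIdeal_eq_of_finrank_residueField_eq
    (hf : haveI := T5InertiaDegree.liesOver_maximalIdeal R₀ F E
      Module.finrank (R₀ ⧸ maximalIdeal R₀)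
        (integralClosure R₀ E ⧸ maximalIdeal (integralClosure R₀ E)) = Module.finrank F E) :
    (maximalIdeal R₀).map (algebraMap R₀ (integralClosure R₀ E)) =
      maximalIdeal (integralClosure R₀ E) := by
  haveI := T5InertiaDegree.liesOver_maximalIdeal R₀ F E
  refine map_maximalIdeal_eq_of_inertiaDeg'_eq R₀ F E ?_
  rw [Ideal.inertiaDeg'_algebraMap]
  exact hf

include F in
/-- **The quadratic case**: `[E : F] = 2` and a residue field extension of degree `2` give
`𝔭_{R₀} 𝒪_E = 𝔭_{𝒪_E}` — the record's «inert» in the residue-field sense. -/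
theorem map_maximalIdeal_eq_of_finrank_residueField_eq_two (h2 : Module.finrank F E = 2)
    (hf : haveI := T5InertiaDegree.liesOver_maximalIdeal R₀ F E
      Module.finrank (R₀ ⧸ maximalIdeal R₀)
        (integralClosure R₀ E ⧸ maximalIdeal (integralClosure R₀ E)) = 2) :
    (maximalIdeal R₀).map (algebraMap R₀ (integralClosure R₀ E)) =
      maximalIdeal (integralClosure R₀ E) :=
  map_maximalIdeal_eq_of_finrank_residueField_eq R₀ F E (by rw [hf, h2])

end Summit.Ventures.HodgeRepro2.T5UnramifiedOfInertia
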